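import Summits.QuantumFields.YangMills.Theorems.BalabanUVNodesN12NearFlatFederbushFibreWindow

/-!
# BalabanUVNodes ∕ N12 — THE WINDOW-FORM `hm` CLAUSE WITH THE REGION LETTERS DISCHARGED: THE BLOCK TOWER OF THE WINDOW
# (`S_i := castSite″ box (L^{k−i}(m+1) − 1) (L^{k−i}·lo)`, closed under the block runs of g0's chain), so that `W` need only contain the fine plaquettes SOURCED in the level-0 tower box

Cell `pub-ymgap` (HUMAN RULINGS D-0062 ∕ D-0149), width seat `pub-ymgap-dag-n12-w4` g5 (INTENT-5; sequel of `…N12NearFlatFederbushFibreWindow`, INTENT-4).  Key K1⁹ `stmt-QuantumFields-27364`,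
`--kind proof --supports … --as helper`; count-neutral; THEOREMS ONLY (0 `def`, 0 `sorry`, 0 `instance`).  WHY: p611770's knit edition `exists_m_hm_twisted_window_of_isMinimizer_family` discharged
the nested plaquette-site sets with `S_i := univ` below level `k` — harmless against the FULL flat second variation, but against the window form `B_W` it would force `W = univ`.  Here the sets are
the block tower of the window box: a site of `S_{i+1}` is `castSite z′` with `z′` in the box of side `L^{k−i−1}(m+1) − 1` at `L^{k−i−1}·lo`; its block sites run by `< L` steps in two directions have
labels `L·z′ + r + s·e₀ + t·e_ν` (`blockSite_castSite`, `runSite_castSite` — exact `ZMod` arithmetic, `sitesPerDir i = sitesPerDir (i+1)·L`), inside the box of side `L·(side′ + 1) − 1 = L^{k−i}(m+1) − 1`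
at `L^{k−i}·lo` — NO non-wrapping hypothesis is needed (the sets are images).  CONSUMED BY NAME: INTENT-4's `exists_m_hm_twisted_windowForm_of_isMinimizer_family`, `TorusGeometry`'s `Site.blockSite`
∕ `sitesPerDir_eq_mul_succ`, `T4AxialGaugeSmallField.castSite`, `LatticeFieldCalculus.runSite`, `B16Eq18Proof.box` ∕ `mem_box`.

THE PRINT.  [Balaban1989LargeFieldII] (1.7) p. 358 (the window `B^k(Λ₀)`); [Federbush1986PhaseCellI] (1.3)–(1.9) pp. 322–323 (the averaging blocks under a plaquette); [Balaban1984PropagatorsI]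
(1.7) p. 18 (the straight contours `[x, x + L e_μ]` of the block average).

CONTENTS.  §1 tower bookkeeping: `blockSite_castSite`, `runSite_castSite`, ★ `runSite_runSite_blockSite_mem_tower` (closure of the tower under g0's block runs).
§2 ★★★ `exists_m_hm_twisted_windowForm_knit_of_isMinimizer_family` — p611770's knit edition VERBATIM (placement letter `hΩw` on the window, twist size `hW′`) + `(W, hW)` with
`hW : ∀ q, q.src ∈ castSite″ box (L^k(m+1) − 1) (L^k·lo) → q ∈ W`, conclusion against `B_W`.

HONEST FRAMING.  Lattice bookkeeping + composition BY NAME; per-height raw-unit `γ₀`; nothing of Bałaban's asserted; N12 NOT discharged; K1⁹ NOT closed; count-neutral (typed 28∕28 ·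
discharged 5∕27 unmoved); one finite 𝕋⁴ programme at fixed ε — R4 closes the conditional rung `BalabanLadder.UV` only; the YM mass gap (Clay) is NOT proved by any of this.
-/

noncomputable section

open scoped BigOperators Matrix.Norms.L2Operator InnerProductSpace
open Filter Topology Finset

namespace Summit.QuantumFields.YangMills.BalabanUVNodes.N12NearFlatFederbushFibreWindowKnit

open Literature.MathematicalPhysics.QuantumFieldTheory.Balaban1983to89
open Literature.MathematicalPhysics.QuantumLattice (quatMatrix)
open T4Continuum (T4Family)
open T4HaarSU2ExpChart (imQuat)
open T4AdjointCovarianceUnitary (lieSU)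
open B15Prop1ChartSU2 (su2Chart)
open B16Sect1Backgrounds (expMul)
open B15DeterminingSets GaugeField
open B14.Eq213DetSet (Bj maxDomT)
open B15Prop1SliceCoordinates (GaugeSlice ιA)
open T4AxialGaugeSmallField (castSite castSite_apply)
open B7Prop1Explicit (e e_apply)
open B6TreeGaugePoincare (curl)
open B16Eq18Proof (box mem_box)
open LatticeFieldCalculus (runSite)
open BlockAveragingEMLLinearised (linAvg)
open Literature.MathematicalPhysics.QuantumFieldTheory.BalabanImbrieJaffe1984to88.BIJ85Eq453GaugeField (qsstarGIter0)
open Node00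
open Summit.QuantumFields.YangMills.BalabanUVNodes.N12NearFlatFederbushFibreWindow (exists_m_hm_twisted_windowForm_of_isMinimizer_family)

/-! ## §1  The block tower of a window -/

section Tower

variable {P : Params} {i : ℕ}

/-- **A BLOCK SITE OVER A CAST SITE IS A CAST SITE**: `blockSite (castSite z′) r = castSite (L·z′ + r)` one level down (`sitesPerDir i = sitesPerDir (i+1)·L`; exact `ZMod` arithmetic:
`L·(z′ mod n′) ≡ L·z′ (mod n′L)`). [cite: Balaban1984PropagatorsI, (1.7) p.18 (bookkeeping); Balaban1982Higgs1, (1.17) p.606] -/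
theorem blockSite_castSite (hi : i + 1 ≤ P.m + P.K) (z : Fin P.d → ℤ) (r : Fin P.d → Fin P.L) :
    Site.blockSite (castSite z : Site P (i + 1)) r = (castSite (fun κ => (P.L : ℤ) * z κ + (r κ : ℕ)) : Site P i) := by
  funext κ
  simp only [Site.blockSite, castSite_apply]
  rw [P.sitesPerDir_eq_mul_succ hi]
  set n' := P.sitesPerDir (i + 1) with hn'
  have hval : (((z κ : ℤ) : ZMod n').val : ℤ) = z κ % (n' : ℤ) := ZMod.val_intCast (z κ)
  have h1 : (((((z κ : ℤ) : ZMod n').val * P.L + (r κ : ℕ) : ℕ) : ℤ) : ZMod (n' * P.L))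
      = (((P.L : ℤ) * z κ + ((r κ : ℕ) : ℤ) : ℤ) : ZMod (n' * P.L)) := by
    rw [ZMod.intCast_eq_intCast_iff_dvd_sub]
    push_cast
    rw [hval, Int.emod_def]
    exact ⟨z κ / (n' : ℤ), by ring⟩
  have h2 : ((((z κ : ℤ) : ZMod n').val * P.L + (r κ : ℕ) : ℕ) : ZMod (n' * P.L))
      = (((((z κ : ℤ) : ZMod n').val * P.L + (r κ : ℕ) : ℕ) : ℤ) : ZMod (n' * P.L)) := by push_cast; rfl
  rw [h2, h1]

/-- **A STRAIGHT RUN FROM A CAST SITE IS A CAST SITE**: `runSite (castSite w) μ t = castSite (w + t·e_μ)`. [cite: Balaban1984PropagatorsI, (1.7) p.18 (bookkeeping)] -/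
theorem runSite_castSite (w : Fin P.d → ℤ) (μ : Fin P.d) (t : ℕ) :
    runSite (castSite w : Site P i) μ t = castSite (fun κ => w κ + if κ = μ then (t : ℤ) else 0) := by
  funext κ
  simp only [runSite, castSite_apply, Function.update_apply]
  split_ifs with h
  · subst h; push_cast; rfl
  · simp

variable {k : ℕ}

/-- ★ **THE TOWER IS CLOSED UNDER THE BLOCK RUNS OF g0's CHAIN**: if `y ∈ S_{i+1} = castSite″ box (L^{k−i−1}(m+1) − 1) (L^{k−i−1}·lo)` then for every block offset `r`, every `s, t < L` and
`ν ≠ e₀`, `runSite (runSite (blockSite y r) e₀ s) ν t ∈ S_i = castSite″ box (L^{k−i}(m+1) − 1) (L^{k−i}·lo)` — labels `L·z′ + r + s·e₀ + t·e_ν` stay in the box of side `L·side′ + L − 1`.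
[cite: Federbush1986PhaseCellI, (1.3)–(1.9) pp.322–323; Balaban1984PropagatorsI, (1.7) p.18] -/
theorem runSite_runSite_blockSite_mem_tower (h0 : 0 < P.d) (hik : i < P.m + P.K) {ν : Fin P.d} (hν : (⟨0, h0⟩ : Fin P.d) ≠ ν) (hi : i < k)
    {m : Fin P.d → ℕ} {lo : Fin P.d → ℤ} {y : Site P (i + 1)}
    (hy : y ∈ (box (fun κ => P.L ^ (k - (i + 1)) * (m κ + 1) - 1) (fun κ => (P.L : ℤ) ^ (k - (i + 1)) * lo κ)).image (fun z => (castSite z : Site P (i + 1))))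
    (r : Fin P.d → Fin P.L) {s t : ℕ} (hs : s < P.L) (ht : t < P.L) :
    runSite (runSite (Site.blockSite y r) ⟨0, h0⟩ s) ν t
      ∈ (box (fun κ => P.L ^ (k - i) * (m κ + 1) - 1) (fun κ => (P.L : ℤ) ^ (k - i) * lo κ)).image (fun z => (castSite z : Site P i)) := by
  classical
  rw [Finset.mem_image] at hy
  obtain ⟨z, hz, rfl⟩ := hy
  rw [blockSite_castSite (by omega) z r, runSite_castSite, runSite_castSite, Finset.mem_image]
  refine ⟨_, ?_, rfl⟩
  rw [mem_box] at hz ⊢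
  intro κ
  obtain ⟨hlo, hhi⟩ := hz κ
  have hL : 1 < P.L := P.hL.2
  have hLpos : (0 : ℤ) < P.L := by exact_mod_cast P.L_pos
  have hpow : (P.L : ℤ) ^ (k - i) = (P.L : ℤ) ^ (k - (i + 1)) * P.L := by
    rw [show k - i = (k - (i + 1)) + 1 by omega, pow_succ]
  have hside : ((P.L ^ (k - i) * (m κ + 1) - 1 : ℕ) : ℤ) = ((P.L ^ (k - (i + 1)) * (m κ + 1) - 1 : ℕ) : ℤ) * P.L + (P.L - 1 : ℤ) := by
    have h1 : 1 ≤ P.L ^ (k - (i + 1)) * (m κ + 1) := Nat.one_le_iff_ne_zero.mpr (by positivity)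
    have h2 : 1 ≤ P.L ^ (k - i) * (m κ + 1) := Nat.one_le_iff_ne_zero.mpr (by positivity)
    rw [Nat.cast_sub h2, Nat.cast_sub h1]
    push_cast
    rw [show ((P.L : ℤ)) ^ (k - i) = (P.L : ℤ) ^ (k - (i + 1)) * P.L from hpow]
    ring
  have hr : ((r κ : ℕ) : ℤ) < P.L := by exact_mod_cast (r κ).isLt
  have hr0 : (0 : ℤ) ≤ ((r κ : ℕ) : ℤ) := by positivity
  have hs' : (s : ℤ) < P.L := by exact_mod_cast hs
  have ht' : (t : ℤ) < P.L := by exact_mod_cast ht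
  constructor
  · -- lower face: `L^{k−i}·lo ≤ L·z′ + r + …`
    rw [hpow]
    have : (P.L : ℤ) ^ (k - (i + 1)) * lo κ * P.L ≤ (P.L : ℤ) * z κ := by nlinarith
    split_ifs <;> nlinarith
  · -- upper face: `L·z′ + r + s·[κ = 0] + t·[κ = ν] < L^{k−i}·lo + (L^{k−i}(m+1) − 1)`
    rw [hside, hpow]
    have hz1 : z κ + 1 ≤ (P.L : ℤ) ^ (k - (i + 1)) * lo κ + ((P.L ^ (k - (i + 1)) * (m κ + 1) - 1 : ℕ) : ℤ) := by omega
    have hmain : (P.L : ℤ) * z κ + ((r κ : ℕ) : ℤ) + (P.L - 1)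
        < (P.L : ℤ) ^ (k - (i + 1)) * lo κ * P.L + (((P.L ^ (k - (i + 1)) * (m κ + 1) - 1 : ℕ) : ℤ) * P.L + (P.L - 1 : ℤ)) := by nlinarith
    by_cases hκ0 : κ = ⟨0, h0⟩
    · subst hκ0
      rw [if_pos rfl, if_neg hν]
      linarith
    · rw [if_neg hκ0]
      by_cases hκν : κ = ν
      · rw [if_pos hκν]; linarith
      · rw [if_neg hκν]; linarith

end Tower

/-! ## §2  The window-form `hm` clause with the region letters discharged -/

section Knit

variable {F : T4Family} {K k M₁ : ℕ}

/-- ★★★ **THE J-C CLAUSE AGAINST THE WINDOW FORM, KNIT EDITION** — p611770's `exists_m_hm_twisted_window_of_isMinimizer_family` VERBATIM (the `linAvg` iterate built inside, the placement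
letter `hΩw` on the window itself, the twist size `hW′`) + a finite set `W` of FINE plaquettes containing every plaquette sourced in the level-0 tower box
`castSite″ box (L^k(m+1) − 1) (L^k·lo)` of the window: `∃ m, (∀ w′, DΦ♭(0)w′ = DΨ(0)(X_f′X) → m ≤ B_W w′ w′) ∧ γ₀·circ(X) − γ₀·16(d+1)τ‖X‖² ≤ m` (INTENT-4 with `S_i :=` the block tower, §1).
[cite: Balaban1989LargeFieldII, (1.7) pp.357–358, (1.12) p.359; Balaban1989LargeFieldI, (1.74) p.192, Prop. 1 p.194; Balaban1988Convergent, (2.10)–(2.13) pp.256–257; Federbush1986PhaseCellI, (1.3)–(1.9) pp.322–323] -/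
theorem exists_m_hm_twisted_windowForm_knit_of_isMinimizer_family (h0 : 0 < (F.P K).d) (hk : k ≤ (F.P K).m + (F.P K).K)
    (Z : Set (Site (F.P K) 0)) {S : Set (Site (F.P K) k)} {T : Finset (PBond (F.P K) k)} (X : GaugeSlice S T (EuclideanSpace ℝ (Fin 3)))
    {m : Fin (F.P K).d → ℕ} (lo : Fin (F.P K).d → ℤ) (hm : ∀ κ, (m κ : ℤ) ≤ (F.P K).sitesPerDir k)
    {φ : EuclideanSpace ℝ (Fin 3) →ₗ[ℝ] lieSU (Fin 2)} (hφ : ∀ v, ((φ v : lieSU (Fin 2)) : Matrix (Fin 2) (Fin 2) ℂ) = quatMatrix (imQuat v))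
    (W : Finset (Plaq (F.P K) 0)) (hW : ∀ q : Plaq (F.P K) 0, q.src ∈ ((box (fun κ => (F.P K).L ^ k * (m κ + 1) - 1) (fun κ => ((F.P K).L : ℤ) ^ k * lo κ)).image (fun z => (castSite z : Site (F.P K) 0))) → q ∈ W)
    (hΩw : ∀ (ν : Fin (F.P K).d), ∀ z ∈ box m lo,
      (castSite z : Site (F.P K) k) ∈ pts k (maxDomT M₁ Z k) ∧ (castSite z : Site (F.P K) k).shift ⟨0, h0⟩ ∈ pts k (maxDomT M₁ Z k) ∧
        (castSite z : Site (F.P K) k).shift ν ∈ pts k (maxDomT M₁ Z k))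
    (reg : Set (GaugeField (F.P K) 0 (SU 2))) (V : GaugeField (F.P K) k (SU 2)) (U₀ : GaugeField (F.P K) 0 (SU 2))
    {Xf : GaugeSlice S T (EuclideanSpace ℝ (Fin 3)) → PBond (F.P K) 0 → lieSU (Fin 2)} (hX₀ : Xf 0 = 0)
    (hmin : ∀ᶠ Y in 𝓝 (0 : GaugeSlice S T (EuclideanSpace ℝ (Fin 3))),
      IsMinimizer (avOfRecord F 2 K) reg (Bj M₁ Z k) (avgFamily (avOfRecord F 2 K) (qsstarGIter0 k (expMul su2Chart (ιA S T Y) V))) (expChart U₀ (Xf Y)))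
    {X' : GaugeSlice S T (EuclideanSpace ℝ (Fin 3)) →L[ℝ] PBond (F.P K) 0 → lieSU (Fin 2)} (hX : HasFDerivAt Xf X' 0)
    (hΨ : DifferentiableAt ℝ (msChart F 2 K k (Bj M₁ Z k) (avgFamily (avOfRecord F 2 K) (qsstarGIter0 k V)) U₀) 0)
    {τ : ℝ} (hτ : 0 < τ)
    (hW' : ∀ c ∈ bondsOf (Bj M₁ Z k k), ‖((avgFamily (avOfRecord F 2 K) (qsstarGIter0 k V) k c : SU 2) : Matrix (Fin 2) (Fin 2) ℂ) - 1‖ ≤ τ / 2) :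
    ∃ m' : ℝ,
      (∀ w' : PBond (F.P K) 0 → lieSU (Fin 2),
        fderiv ℝ (msChart F 2 K k (Bj M₁ Z k) (avgFamily (avOfRecord F 2 K) (1 : GaugeField (F.P K) 0 (SU 2))) (1 : GaugeField (F.P K) 0 (SU 2))) 0 w'
            = fderiv ℝ (msChart F 2 K k (Bj M₁ Z k) (avgFamily (avOfRecord F 2 K) (qsstarGIter0 k V)) U₀) 0 (X' X) →
        m' ≤ ((Fintype.card (Fin 2) : ℝ)⁻¹ • ∑ p ∈ W, (innerSL ℝ (E := lieSU (Fin 2))).bilinearComp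
              (ContinuousLinearMap.proj (R := ℝ) (φ := fun _ : PBond (F.P K) 0 => lieSU (Fin 2)) (⟨p.src, p.μ⟩ : PBond (F.P K) 0) + ContinuousLinearMap.proj (R := ℝ) (φ := fun _ : PBond (F.P K) 0 => lieSU (Fin 2)) (⟨p.src.shift p.μ, p.ν⟩ : PBond (F.P K) 0)
                - ContinuousLinearMap.proj (R := ℝ) (φ := fun _ : PBond (F.P K) 0 => lieSU (Fin 2)) (⟨p.src.shift p.ν, p.μ⟩ : PBond (F.P K) 0) - ContinuousLinearMap.proj (R := ℝ) (φ := fun _ : PBond (F.P K) 0 => lieSU (Fin 2)) (⟨p.src, p.ν⟩ : PBond (F.P K) 0) : (PBond (F.P K) 0 → lieSU (Fin 2)) →L[ℝ] lieSU (Fin 2))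
              (ContinuousLinearMap.proj (R := ℝ) (φ := fun _ : PBond (F.P K) 0 => lieSU (Fin 2)) (⟨p.src, p.μ⟩ : PBond (F.P K) 0) + ContinuousLinearMap.proj (R := ℝ) (φ := fun _ : PBond (F.P K) 0 => lieSU (Fin 2)) (⟨p.src.shift p.μ, p.ν⟩ : PBond (F.P K) 0)
                - ContinuousLinearMap.proj (R := ℝ) (φ := fun _ : PBond (F.P K) 0 => lieSU (Fin 2)) (⟨p.src.shift p.ν, p.μ⟩ : PBond (F.P K) 0) - ContinuousLinearMap.proj (R := ℝ) (φ := fun _ : PBond (F.P K) 0 => lieSU (Fin 2)) (⟨p.src, p.ν⟩ : PBond (F.P K) 0) : (PBond (F.P K) 0 → lieSU (Fin 2)) →L[ℝ] lieSU (Fin 2))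
              : (PBond (F.P K) 0 → lieSU (Fin 2)) →L[ℝ] (PBond (F.P K) 0 → lieSU (Fin 2)) →L[ℝ] ℝ) w' w') ∧
      (((F.P K).L : ℝ) ^ (F.P K).d) ^ k / ((((F.P K).L : ℝ)) ^ 2 * ((F.P K).L : ℝ) ^ 2) ^ k *
            (∑ z ∈ box m lo, ∑ μ : Fin (F.P K).d, ∑ a : Fin 3, curl (fun b => ιA S T X (⟨castSite b.1, b.2⟩ : PBond (F.P K) k) a) z ⟨0, h0⟩ μ ^ 2)
          - (((F.P K).L : ℝ) ^ (F.P K).d) ^ k / ((((F.P K).L : ℝ)) ^ 2 * ((F.P K).L : ℝ) ^ 2) ^ k * (16 * (((F.P K).d : ℝ) + 1) * τ) * ‖X‖ ^ 2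
        ≤ m' := by
  classical
  -- the `linAvg` iterate (as in p611770)
  let Q : (i : ℕ) → (PBond (F.P K) 0 → Matrix (Fin 2) (Fin 2) ℂ) → PBond (F.P K) i → Matrix (Fin 2) (Fin 2) ℂ := fun i =>
    Nat.rec (motive := fun i => (PBond (F.P K) 0 → Matrix (Fin 2) (Fin 2) ℂ) → PBond (F.P K) i → Matrix (Fin 2) (Fin 2) ℂ)
      (fun Y => Y) (fun _ q Y c => linAvg (q Y) c) i
  have hQ0 : ∀ Y, Q 0 Y = Y := fun Y => rfl
  have hQs : ∀ (i : ℕ) (Y : PBond (F.P K) 0 → Matrix (Fin 2) (Fin 2) ℂ) (c : PBond (F.P K) (i + 1)), Q (i + 1) Y c = linAvg (Q i Y) c :=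
    fun i Y c => rfl
  -- the BLOCK TOWER of the window: `S_i := castSite″ box (L^{k−i}(m+1) − 1) (L^{k−i}·lo)`
  let Sset : (i : ℕ) → Finset (Site (F.P K) i) := fun i =>
    (box (fun κ => (F.P K).L ^ (k - i) * (m κ + 1) - 1) (fun κ => ((F.P K).L : ℤ) ^ (k - i) * lo κ)).image (fun z => (castSite z : Site (F.P K) i))
  have hSk : Sset k = (box m lo).image (fun z => (castSite z : Site (F.P K) k)) := by
    simp only [Sset, Nat.sub_self, pow_zero, one_mul, Nat.add_sub_cancel]
  have hwin : ∀ z ∈ box m lo, (castSite z : Site (F.P K) k) ∈ Sset k := fun z hz => by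
    rw [hSk]
    exact Finset.mem_image_of_mem _ hz
  have hS : ∀ (ν : Fin (F.P K).d), (⟨0, h0⟩ : Fin (F.P K).d) ≠ ν → ∀ i, i < k → ∀ y ∈ Sset (i + 1), ∀ (r : Fin (F.P K).d → Fin (F.P K).L) (s t : ℕ),
      s < (F.P K).L → t < (F.P K).L → runSite (runSite (Site.blockSite y r) ⟨0, h0⟩ s) ν t ∈ Sset i := by
    intro ν hν i hi y hy r s t hs ht
    exact runSite_runSite_blockSite_mem_tower h0 (lt_of_lt_of_le hi hk) hν hi hy r hs ht
  have hΩk : ∀ (ν : Fin (F.P K).d), ∀ s ∈ Sset k, s ∈ pts k (maxDomT M₁ Z k) ∧ s.shift ⟨0, h0⟩ ∈ pts k (maxDomT M₁ Z k) ∧ s.shift ν ∈ pts k (maxDomT M₁ Z k) := by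
    intro ν s hs
    rw [hSk, Finset.mem_image] at hs
    obtain ⟨z, hz, rfl⟩ := hs
    exact hΩw ν z hz
  have hW0 : ∀ q : Plaq (F.P K) 0, q.src ∈ Sset 0 → q ∈ W := fun q hq => hW q (by simpa only [Sset, Nat.sub_zero] using hq)
  exact exists_m_hm_twisted_windowForm_of_isMinimizer_family h0 hk Q hQ0 hQs Z X lo hm Sset hwin hS hφ W hW0 hΩk reg V U₀ hX₀ hmin hX hΨ hτ hW'

end Knit

end Summit.QuantumFields.YangMills.BalabanUVNodes.N12NearFlatFederbushFibreWindowKnit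

end
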